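import Summits.BirchSwinnertonDyer.BirchSwinnertonDyer.Theorems.ThetaPartnerAtTwoSignedMainConjectureCMTwoRankZeroOfPubOfFlatOfKZ
import Summits.BirchSwinnertonDyer.BirchSwinnertonDyer.Theorems.ThetaPartnerAtTwoSignedMainConjectureCMTwoRankZeroOfPubMuSplitGlue
import HarnessLib

/-! # Skeleton line `rankzero` v15 — DERIVED NODE K2r0P `SignedMainConjectureCMTwoRankZeroOfPub` (item stmt-BirchSwinnertonDyer-24945;
route ThetaPartnerAtTwo rev 42; lead prover bsd-wall-tp2-p2 g11, 2026-08-28)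

v15 supersedes v14 (68851f95fafc3a88, lead g8): the research stub (LD±2^k)_A `stub_signedLowerDivisibilityUpToTwoPowerNonUnitCMTwo` is RETIRED —
its content is the μ-free twin K2R0P♭ stmt-BirchSwinnertonDyer-26471, whose kernel part is LANDED (registered stub `stub_poitouTateDeepTwo` p636500,
composition p632409, ONE-hypothesis certificate p638949 `SignedLowerOffTwo.signedMainConjectureCMTwoRankZeroOfPubOfFlat_of_zetaErlKSide : KZ → K2R0P♭`).
So 24945 = FLAT ∧ KZ, both PUBLISHED-INPUT / declared-residual shaped, glued by the tree theorem
`Theorems.signedMainConjectureCMTwoRankZeroOfPub_of_flat_of_ofPubOfFlat` (p613233, `…OfPubMuSplitGlue`). Stubs (2):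
* `stub_analyticMuFlatNonUnitCMTwo` ((μ♭)_A, UNCHANGED from v11–v14 = the body of the route item FLAT `AnalyticMuFlatCMTwoRankZero`
  (stmt-BirchSwinnertonDyer-26470, declared residual; certificate-grade per class, FLAT-CENSUS 762/762), by `Iff.rfl`);
* `stub_zetaErlKSideCMTwo` (KZ — VERBATIM the one registered stub of 26471's skeleton v21 = crux dir `SignedMainConjectureCMTwoRankZeroOfPubOfFlat/KZText.lean`
  / `KZHold.lean`; PUB: Kato 2004 Thm. 12.5, Prop. 15.9, (15.12.2), Lemma 15.13, §15.15, (15.16.1), Prop. 15.17; Kobayashi 2003 (8.23); Johnson-Leung–Kings 2011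
  Thm. 5.2/5.7 §7.2 (regular primes, all p); to be filed by the pen as ONE PUB/HOLD route item — memo `…/KZ-DESIGN-g11.md`).
Composition: kernel-checked, no sorry of its own. BSD is not proved by any of this; neither 24945 nor 26471 is closed by this file.
-/

set_option autoImplicit false
set_option linter.dupNamespace false

noncomputable section

open scoped Classical NumberField MatrixGroups ModularForm

open NumberField IsDedekindDomain CongruenceSubgroup WeierstrassCurve Literature Literature.NumberTheory.EllipticCurves
  Literature.NumberTheory.GaloisRepresentations Literature.NumberTheory.EllipticCurves.ModularForms
  Literature.NumberTheory.EllipticCurves.Rank1Residual Literature.NumberTheory.EllipticCurves.IwasawaDual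
  Literature.NumberTheory.EllipticCurves.Kobayashi2003 Literature.NumberTheory.EllipticCurves.GreenbergVatsal2000
  Literature.NumberTheory.EllipticCurves.Module Literature.NumberTheory.EllipticCurves.Kato2004 Literature.NumberTheory.EllipticCurves.Kato2004.EulerSystemValues
  Literature.NumberTheory.EllipticCurves.GreenbergSelmer Literature.NumberTheory.EllipticCurves.Sprung2012
  ZpExtension Summit.BirchSwinnertonDyer.Rank1Residual.Supersingular
  Summit.BirchSwinnertonDyer.BirchSwinnertonDyer.Theorems.SignedKatoOffTwo

namespace Summit.BirchSwinnertonDyer.BirchSwinnertonDyer.Cruxes.SignedMainConjectureCMTwoRankZeroOfPub.RankZero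

/-- (μ♭_A OFF the unit zone — research stub) Analytic `μ = 0` at `2` for CM newforms of analytic rank `0` with
`2 ∣ #Ш(A)·∏c_ℓ(A)`: Kobayashi's `L⁺ = L♭` has a unit coefficient (in the unit zone `L♭(0)` itself is a unit).
[cite: KuriharaOtsuki2006, Rem. 0.2 (3)] [cite: Pollack2003, Thm. 5.6] -/
theorem stub_analyticMuFlatNonUnitCMTwo :
    ∀ (A : WeierstrassCurve ℚ) [A.IsElliptic] [A.IsGloballyMinimal],
      A.HasCM → A.analyticRank = 0 → GoodSS A 2 → A.frobeniusTrace 2 = 0 →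
      2 ∣ A.shaOrder * A.tamagawaProduct →
      ∀ [NeZero (A.conductorNorm ℤ)] (f : CuspForm (Gamma0 (A.conductorNorm ℤ)) 2),
      IsNewformOf A f → ∀ (Lplus Lminus : IwasawaAlgebra 2), IsPollackPair f 2 Lplus Lminus →
        ∃ n : ℕ, IsUnit (PowerSeries.coeff n (kobayashiL 1 Lplus Lminus)) := by
  sorry

/-- (KZ — PUB-shaped; VERBATIM the registered stub `stub_zetaErlKSideCMTwo` of 26471's skeleton `rankzero` v21) Kato's zeta-element package for the CM newform
`f_A` at `p = 2`, at every height-one `𝔭′ ∌ 2` of `Λ`: a local generator `g`, a plus Honda system `d` ((L)(TR)(GEN)(GEN₀)), a class `s ∈ 𝐇¹_Γ(T₂A)` with the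
explicit reciprocity law (ERL_pair) ON THE layer Tate pairings against the Mazur–Tate elements of `f_A` (`μ, ν ∉ 𝔭′`), and the K-side transport datum
`KatoDescent.KSideDatum I Y s 𝔭′` (elliptic-unit tower, JLK Thm. 5.7 at the regular primes, §15.1, Lemma 15.13 / (15.16.1) / §15.15 socket).
[cite: Kato2004Asterisque, Thm. 12.5 (p. 222), Prop. 15.9, (15.12.2), Lemma 15.13, §15.15, (15.16.1), Prop. 15.17 (pp. 258–265)]
[cite: Kobayashi2003, (8.23) (p. 18)] [cite: JohnsonLeungKings2011, Thm. 5.2, Thm. 5.7 and §7.2] -/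
theorem stub_zetaErlKSideCMTwo :
    ∀ (v : HeightOneSpectrum (𝓞 ℚ)), ((2 : ℕ) : 𝓞 ℚ) ∈ v.asIdeal →
      ∀ (A : WeierstrassCurve ℚ) [A.IsElliptic] [A.IsGloballyMinimal],
        A.HasCM → A.analyticRank = 0 → GoodSS A 2 → A.frobeniusTrace 2 = 0 →
        2 ∣ A.shaOrder * A.tamagawaProduct →
        ∀ (κ : ZpExtension ℚ 2) (γ : Field.absoluteGaloisGroup ℚ),
          κ.IsCyclotomic → κ.IsTopGenerator γ → IsCyclotomicVariable 2 γ →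
        ∀ [NeZero (A.conductorNorm ℤ)] (f : CuspForm (Gamma0 (A.conductorNorm ℤ)) 2),
          IsNewformOf A f → ∀ (ϖ : ℚ), (ϖ : ℝ) * A.realPeriodRat = plusPeriod f →
        ∀ (Lplus Lminus : IwasawaAlgebra 2), IsPollackPair f 2 Lplus Lminus →
        ∀ [ContinuousSMul ℤ_[2] (A.tateModule 2)] (Y : A.FineSelmerDualData κ γ),
        ∀ 𝔭' : PrimeSpectrum (IwasawaAlgebra 2), 𝔭'.asIdeal.height = 1 →
          PowerSeries.C (2 : ℤ_[2]) ∉ 𝔭'.asIdeal →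
        ∀ (I : Kato2004.IwasawaH1Data A 2 κ γ)
          (pair : ∀ n : ℕ, H1 (tateRep A 2) (κ.layerSubgroup n) →ₗ[ℤ_[2]]
            (localLayerPointsOfEmb κ (closureEmb (K := ℚ) (v.adicCompletion ℚ)) A n →+ ℤ_[2])),
          -- (P1) projection formula
          (∀ (n : ℕ) (x : H1 (tateRep A 2) (κ.layerSubgroup (n + 1))) (Q : localPoints A (v.adicCompletion ℚ))
            (hQ : Q ∈ localLayerPointsOfEmb κ (closureEmb (K := ℚ) (v.adicCompletion ℚ)) A n),
            pair n (layerCores (tateRep A 2) κ n x) ⟨Q, hQ⟩ =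
              pair (n + 1) x ⟨Q, localLayerPointsOfEmb_mono κ (closureEmb (K := ℚ) (v.adicCompletion ℚ)) A (Nat.le_succ n) hQ⟩) →
          -- (P2) Galois invariance, for EVERY `g ∈ Γ_v`
          (∀ (n : ℕ) (g : Field.absoluteGaloisGroup (v.adicCompletion ℚ)) (y : H1 (tateRep A 2) (κ.layerSubgroup n))
            (Q : localPoints A (v.adicCompletion ℚ))
            (hQ : Q ∈ localLayerPointsOfEmb κ (closureEmb (K := ℚ) (v.adicCompletion ℚ)) A n),
            pair n (conjMap (tateRep A 2).toTopRep (κ.layerSubgroup n) (resGalOfEmb (closureEmb (K := ℚ) (v.adicCompletion ℚ)) g) 1 y)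
              ⟨g • Q, smul_mem_localLayerPointsOfEmb κ (closureEmb (K := ℚ) (v.adicCompletion ℚ)) A n g hQ⟩ = pair n y ⟨Q, hQ⟩) →
          -- (P3) residue clause: `pair` IS the `T₂A`-adic local Tate pairing (THE Weil pairings of the tree)
          (∀ (n k : ℕ) (x : H1 (tateRep A 2) (κ.layerSubgroup n))
            (Q : localLayerPointsOfEmb κ (closureEmb (K := ℚ) (v.adicCompletion ℚ)) A n),
            PadicInt.toZModPow k (pair n x Q) =
              LayerPairing.layerPairingPk A κ v (LayerPairing.weilTowerPk A) (LayerPairing.weilTowerPk_pow A)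
                (LayerPairing.weilTowerPk_add_left A) (LayerPairing.weilTowerPk_add_right A) (LayerPairing.weilTowerPk_smul A)
                n k x Q) →
        ∃ (g : Field.absoluteGaloisGroup (v.adicCompletion ℚ))
          (_ : κ.IsTopGenerator (resGalOfEmb (closureEmb (K := ℚ) (v.adicCompletion ℚ)) g))
          (d : ℕ → localPoints A (v.adicCompletion ℚ)) (s : I.H),
          (∀ n, d n ∈ localLayerPointsOfEmb κ (closureEmb (K := ℚ) (v.adicCompletion ℚ)) A n) ∧
          (∀ n, localTraceOfEmb κ (closureEmb (K := ℚ) (v.adicCompletion ℚ)) A (n + 1) (n + 2) (d (n + 2)) = -d n) ∧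
          (∀ n : ℕ, 1 ≤ n → ∀ P ∈ localLayerPointsOfEmb κ (closureEmb (K := ℚ) (v.adicCompletion ℚ)) A n,
            ∃ B ∈ AddSubgroup.closure (Set.range fun σ : Field.absoluteGaloisGroup (v.adicCompletion ℚ) ↦ σ • d n),
              ∃ P' ∈ localLayerPointsOfEmb κ (closureEmb (K := ℚ) (v.adicCompletion ℚ)) A (n - 1),
              ∃ R ∈ localLayerPointsOfEmb κ (closureEmb (K := ℚ) (v.adicCompletion ℚ)) A n, P = B + P' + 2 • R) ∧
          (∀ P ∈ localLayerPointsOfEmb κ (closureEmb (K := ℚ) (v.adicCompletion ℚ)) A 0,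
            ∃ a : ℤ, ∃ R ∈ localLayerPointsOfEmb κ (closureEmb (K := ℚ) (v.adicCompletion ℚ)) A 0, P = a • d 0 + 2 • R) ∧
          -- (ERL_pair) ON THE layer pairings: `ν·P_{n,d_n}(pair n (I.proj n s)) ≡ μ·θ_n (mod ω_n)` in `Λ ⊗ ℚ₂`, `μ, ν ∉ 𝔭'`
          (∃ μ ν : IwasawaAlgebra 2, μ ∉ 𝔭'.asIdeal ∧ ν ∉ 𝔭'.asIdeal ∧
            ∀ n : ℕ, ∃ (m : ℕ) (q : IwasawaAlgebra 2),
              PowerSeries.C ((2 : ℚ_[2]) ^ m) *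
                  (iwasawaToPowerSeries 2 μ * ((mazurTateElement f 2 n).map (algebraMap ℚ ℚ_[2]) : PowerSeries ℚ_[2]) -
                    iwasawaToPowerSeries 2 (ν * pairingSum A (localLayerPointsOfEmb κ (closureEmb (K := ℚ) (v.adicCompletion ℚ)) A n)
                      g n (d n) (pair n (I.proj n s)))) =
                iwasawaToPowerSeries 2 (((cyclotomicOmega 2 n).map (Int.castRingHom ℤ_[2]) : PowerSeries ℤ_[2]) * q)) ∧
          -- (g)^ι REPLACED by its typed K-side input: ONE K-side datum (tower + JLK §7.2 + §15.1 + transport socket)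
          Nonempty (Summit.BirchSwinnertonDyer.BirchSwinnertonDyer.Theorems.KatoDescent.KSideDatum I Y s 𝔭') := by
  sorry

/-- COMPOSITION (kernel-checked, no sorry of its own): K2r0P ⟸ FLAT ∧ K2R0P♭ (glue p613233) with K2R0P♭ ⟸ KZ (p638949). -/
theorem SignedMainConjectureCMTwoRankZeroOfPub_of :
    Summit.BirchSwinnertonDyer.BirchSwinnertonDyer.Theses.ThetaPartnerAtTwo.SignedMainConjectureCMTwoRankZeroOfPub :=
  Summit.BirchSwinnertonDyer.BirchSwinnertonDyer.Theorems.signedMainConjectureCMTwoRankZeroOfPub_of_flat_of_ofPubOfFlat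
    stub_analyticMuFlatNonUnitCMTwo
    (Summit.BirchSwinnertonDyer.BirchSwinnertonDyer.Theorems.SignedLowerOffTwo.signedMainConjectureCMTwoRankZeroOfPubOfFlat_of_zetaErlKSide
      stub_zetaErlKSideCMTwo)

end Summit.BirchSwinnertonDyer.BirchSwinnertonDyer.Cruxes.SignedMainConjectureCMTwoRankZeroOfPub.RankZero

end
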